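import Mathlib
import Summits.KontsevichZagierPeriods.KontsevichZagierPeriods.Theses.GammaCornerAnomaly
import Literature.NumberTheory.Transcendental.KZCalculus

/-!
# `LegendreMellinMoment` (stmt-KontsevichZagierPeriods-8981, route GammaCornerAnomaly) — proof

Roy–Vlasenko's `s`-uniform chain for the motivic Gamma function of the Legendre MUM point, inside the
Kontsevich–Zagier calculus: for every rational `s > 0` and ANY two representations on `ℝ² = Fin 2 → ℝ`,
`r = [{0 < t < x < 1}, t^{s−1} (x(1−x)(x−t))^{−1/2}]` (the triangle) and
`r' = [(0,1)², u^{s−1}(1−u)^{−1/2} · x^{s−1}(1−x)^{−1/2}]` (the square, value `B(s,½)²`), pinned by their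
domains and by their integrands ON the domains, `KZ.Equivalent r r'`.

The proof is ONE change of variables (Kontsevich–Zagier rule (2), `KZ.changeOfVariablesRel`) between the
two GIVEN representations: the quotient chart `Φ(u, x) = (ux, x)` maps the open square injectively ONTO
the triangle (inverse `u = t/x`), is a `ℚ`-polynomial map (hence `ℚ`-semialgebraic on the
`ℚ`-semialgebraic square), everywhere differentiable with `det DΦ(u,x) = x > 0`, and on the square the
Jacobian identity `(ux)^{s−1} (x(1−x)(x−ux))^{−1/2} · x = u^{s−1}(1−u)^{−1/2} x^{s−1}(1−x)^{−1/2}` holds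
(`x(1−x)(x−ux) = x²(1−x)(1−u)` and `(x²)^{−1/2} = 1/x`); hence `[r'] − [r] ∈ KZ.changeOfVariablesRel`.
Shaped like the tree's `InverseLandau.tateLifting_betaGammaTruncated` (polar chart of the simplex).

References: M. Kontsevich, D. Zagier, *Periods* (2001), §1.2 rule (2); D. Roy (Golyshev)–M. Vlasenko,
arXiv:2206.15181, p. 2; S. Bloch, M. Vlasenko, arXiv:1908.07501.
-/

noncomputable section

open MeasureTheory Set
open Literature.NumberTheory.Transcendental

namespace Summit.KontsevichZagierPeriods.GammaCornerAnomaly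

namespace LegendreMellinMoment

/-- **The quotient chart `Φ(u,x) = (ux, x)` of the triangle `{0 < t < x < 1}` by the square `(0,1)²`**:
a polynomial map, differentiable everywhere with `det DΦ(u,x) = x`, injective on the open square and
ONTO the open triangle (inverse `u = t/x`). [folklore] -/
theorem exists_quotientChart :
    ∃ (Φ : (Fin 2 → ℝ) → (Fin 2 → ℝ)) (Φ' : (Fin 2 → ℝ) → (Fin 2 → ℝ) →L[ℝ] (Fin 2 → ℝ)),
      (∀ z, Φ z 0 = z 0 * z 1) ∧ (∀ z, Φ z 1 = z 1) ∧
      (∀ z, HasFDerivAt Φ (Φ' z) z) ∧ (∀ z, (Φ' z).det = z 1) ∧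
      Set.InjOn Φ {z : Fin 2 → ℝ | ∀ i, z i ∈ Set.Ioo (0:ℝ) 1} ∧
      Φ '' {z : Fin 2 → ℝ | ∀ i, z i ∈ Set.Ioo (0:ℝ) 1} =
        {z : Fin 2 → ℝ | 0 < z 0 ∧ z 0 < z 1 ∧ z 1 < 1} := by
  -- adapted from `InverseLandau.BetaGammaTruncated.exists_polarChart` (Theorems/InverseLandauTateLiftingBetaGammaTruncated.lean)
  set Φ : (Fin 2 → ℝ) → (Fin 2 → ℝ) := fun z => ![z 0 * z 1, z 1] with hΦ
  set Φ' : (Fin 2 → ℝ) → (Fin 2 → ℝ) →L[ℝ] (Fin 2 → ℝ) :=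
    fun z => LinearMap.toContinuousLinearMap (Matrix.toLin' !![z 1, z 0; 0, 1]) with hΦ'
  have hΦ0 : ∀ z, Φ z 0 = z 0 * z 1 := fun z => rfl
  have hΦ1 : ∀ z, Φ z 1 = z 1 := fun z => rfl
  have hΦ'0 : ∀ z v : Fin 2 → ℝ, Φ' z v 0 = z 1 * v 0 + z 0 * v 1 := by
    intro z v
    change Matrix.toLin' !![z 1, z 0; 0, 1] v 0 = _
    rw [Matrix.toLin'_apply]
    simp [Matrix.mulVec, dotProduct, Fin.sum_univ_two]
  have hΦ'1 : ∀ z v : Fin 2 → ℝ, Φ' z v 1 = v 1 := by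
    intro z v
    change Matrix.toLin' !![z 1, z 0; 0, 1] v 1 = _
    rw [Matrix.toLin'_apply]
    simp [Matrix.mulVec, dotProduct, Fin.sum_univ_two]
  have hdet : ∀ z, (Φ' z).det = z 1 := by
    intro z
    change LinearMap.det (Matrix.toLin' !![z 1, z 0; 0, 1]) = _
    rw [LinearMap.det_toLin', Matrix.det_fin_two_of]
    ring
  have hderiv : ∀ z, HasFDerivAt Φ (Φ' z) z := by
    intro z
    have h0 : HasFDerivAt (fun y : Fin 2 → ℝ => y 0)
        (ContinuousLinearMap.proj (R := ℝ) (φ := fun _ : Fin 2 => ℝ) 0) z := hasFDerivAt_apply 0 z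
    have h1 : HasFDerivAt (fun y : Fin 2 → ℝ => y 1)
        (ContinuousLinearMap.proj (R := ℝ) (φ := fun _ : Fin 2 => ℝ) 1) z := hasFDerivAt_apply 1 z
    rw [hasFDerivAt_pi']
    refine Fin.forall_fin_two.mpr ⟨?_, ?_⟩
    · have hf : (fun y : Fin 2 → ℝ => Φ y 0) = fun y => y 0 * y 1 := funext fun y => rfl
      rw [hf]
      refine (h0.mul h1).congr_fderiv (ContinuousLinearMap.ext fun v => ?_)
      simp [hΦ'0]
      ring
    · have hf : (fun y : Fin 2 → ℝ => Φ y 1) = fun y => y 1 := funext fun y => rfl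
      rw [hf]
      refine h1.congr_fderiv (ContinuousLinearMap.ext fun v => ?_)
      simp [hΦ'1]
  refine ⟨Φ, Φ', hΦ0, hΦ1, hderiv, hdet, ?_, ?_⟩
  · intro x hx y hy hxy
    have e0 := congrFun hxy 0
    have e1 := congrFun hxy 1
    simp only [hΦ0, hΦ1] at e0 e1
    have h0 : x 0 = y 0 := by
      rw [e1] at e0
      exact mul_right_cancel₀ (hy 1).1.ne' e0
    funext i
    fin_cases i
    · exact h0
    · exact e1
  · ext y
    constructor
    · rintro ⟨z, hz, rfl⟩
      have h0 := hz 0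
      have h1 := hz 1
      simp only [mem_setOf_eq, hΦ0, hΦ1]
      refine ⟨mul_pos h0.1 h1.1, ?_, h1.2⟩
      nlinarith [h0.2, h1.1]
    · rintro ⟨hy0, hy01, hy1⟩
      have hx : 0 < y 1 := hy0.trans hy01
      refine ⟨![y 0 / y 1, y 1], ?_, ?_⟩
      · refine Fin.forall_fin_two.mpr ⟨?_, ?_⟩
        · change y 0 / y 1 ∈ Set.Ioo (0:ℝ) 1
          exact ⟨div_pos hy0 hx, (div_lt_one hx).2 hy01⟩
        · change y 1 ∈ Set.Ioo (0:ℝ) 1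
          exact ⟨hx, hy1⟩
      · funext i
        fin_cases i
        · change y 0 / y 1 * y 1 = y 0
          field_simp
        · rfl

/-- **The Jacobian identity of the quotient chart**: for `0 < u < 1`, `0 < x < 1` and any real
exponent `a`, `u^a (1−u)^{−1/2} x^a (1−x)^{−1/2} = (ux)^a (x(1−x)(x−ux))^{−1/2} · x`
(`x(1−x)(x−ux) = x²·(1−x)(1−u)`, `(ux)^a = u^a x^a` and `(x²)^{−1/2} = x⁻¹` for nonnegative bases).
[folklore] -/
theorem jacobian_identity {a u x : ℝ} (hu : 0 < u) (hu1 : u < 1) (hx : 0 < x) (hx1 : x < 1) :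
    u ^ a * (1 - u) ^ (-(1:ℝ) / 2) * x ^ a * (1 - x) ^ (-(1:ℝ) / 2) =
      (u * x) ^ a * (x * (1 - x) * (x - u * x)) ^ (-(1:ℝ) / 2) * x := by
  have h1u : 0 < 1 - u := by linarith
  have h1x : 0 < 1 - x := by linarith
  have e1 : x * (1 - x) * (x - u * x) = x ^ 2 * ((1 - x) * (1 - u)) := by ring
  have e2 : (x ^ 2) ^ (-(1:ℝ) / 2) = x⁻¹ := by
    rw [← Real.rpow_two, ← Real.rpow_mul hx.le]
    norm_num [Real.rpow_neg_one]
  rw [e1, Real.mul_rpow (sq_nonneg x) (mul_nonneg h1x.le h1u.le), Real.mul_rpow h1x.le h1u.le, e2,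
    Real.mul_rpow hu.le hx.le]
  field_simp

end LegendreMellinMoment

/-- **`LegendreMellinMoment`** (route GammaCornerAnomaly, stmt-KontsevichZagierPeriods-8981): for every
rational `s > 0`, any representation `r = [{0 < t < x < 1}, t^{s−1}(x(1−x)(x−t))^{−1/2}]` is equivalent in
the Kontsevich–Zagier calculus to any representation
`r' = [(0,1)², u^{s−1}(1−u)^{−1/2} x^{s−1}(1−x)^{−1/2}]` — by ONE change of variables along the quotient
chart `Φ(u,x) = (ux, x)` of the triangle by the square (`|det DΦ| = x`;
`[r'] − [r] ∈ KZ.changeOfVariablesRel`). [cite: KontsevichZagier2001, §1.2] -/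
theorem legendreMellinMoment_proof :
    Summit.KontsevichZagierPeriods.KontsevichZagierPeriods.Theses.GammaCornerAnomaly.LegendreMellinMoment := by
  intro s _ r r' hrd hri hr'd hr'i
  obtain ⟨Φ, Φ', hΦ0, hΦ1, hderiv, hdet, hinj, himage⟩ := LegendreMellinMoment.exists_quotientChart
  -- the move `[r'] − [r]`: source the square `r'`, target the triangle `r = Φ(r')`
  have hmem : KZ.of r' - KZ.of r ∈ KZ.changeOfVariablesRel := by
    refine ⟨2, r', r, Φ, Φ', ?_, fun x _ => (hderiv x).hasFDerivWithinAt,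
      by rw [hr'd]; exact hinj, by rw [hr'd, hrd, himage], fun z hz => ?_, rfl⟩
    · -- `Φ` is a `ℚ`-polynomial map on the `ℚ`-semialgebraic set `r'.domain`
      convert isSemialgebraicMapOn_aeval r'.isSemialgebraic_domain
        ![MvPolynomial.X 0 * MvPolynomial.X 1, MvPolynomial.X 1] using 2 with z
      funext i
      fin_cases i
      · simp [hΦ0]
      · simp [hΦ1]
    · -- the Jacobian identity on the square
      have hz' : ∀ i, z i ∈ Set.Ioo (0:ℝ) 1 := by rw [hr'd] at hz; exact hz
      have hΦz : Φ z ∈ r.domain := by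
        rw [hrd, ← himage]
        exact mem_image_of_mem Φ hz'
      rw [hr'i hz, hri hΦz, hdet z, abs_of_pos (hz' 1).1]
      simp only [hΦ0, hΦ1]
      exact LegendreMellinMoment.jacobian_identity (hz' 0).1 (hz' 0).2 (hz' 1).1 (hz' 1).2
  exact KZ.Equivalent.symm (KZ.changeOfVariablesRel_subset_relations hmem)

end Summit.KontsevichZagierPeriods.GammaCornerAnomaly

end
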